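import Summits.ResolutionOfSingularities.ResolutionOfSingularities.Theorems.UniversalCellsCampaignW82TwistExponentBounded
import Summits.ResolutionOfSingularities.ResolutionOfSingularities.Theorems.UniformComplexityCampaignW82TwistExponentRegular
import Mathlib.FieldTheory.IsAlgClosed.AlgebraicClosure
import HarnessLib

/-!
# [OURS · L1 W8.2] The bounded / uniform Frobenius-twist steps BY NAME: refuted wherever their hypothesis holds

Cell `res-hironaka` (run/shared/lean/pub/res-hironaka/), LADDER-RESOLUTION rung L (RESCUE), slot W8.2 of
plan/RESCUE-SEED.md, door 2 = route `UniformComplexity`, host item `PrimeModelTransfer`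
(stmt-ResolutionOfSingularities-8933); prover res-L1-s82-pv-2 (gen 4). THESES-FREE LINKS module: imports the OURS
statement file Theorems/UniversalCellsCampaignW82TwistExponentBounded.lean (typer res-L1-type-o6, p515114:
`CampaignW82.HasSmoothFrobeniusTwistModelLe p K f₀ e₀`, `FrobeniusTwistStepBoundedAt / …BoundedRegularAt p M n e₀`,
`FrobeniusTwistStepUniformAt / …UniformRegularAt p M n`) and the gen-3/4 proof files
Theorems/UniformComplexityCampaignW82TwistExponent{Unbounded,Regular}.lean (res-L1-s82-pv-2: the inline theorems), and
records the verdicts BY NAME. One-liners (the typer's probe drafts/ProbeBoundedLinks.lean, credited); no new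
mathematics.

[OURS · L1 W8.2] replaces the role of no printed item; NOT statements of H. Hironaka's manuscript. For every prime `p`
and EVERY field `M` of characteristic `p` (door 1: perfect `M`; door 2: algebraically closed `M`):

* `frobeniusTwistStepBoundedRegularAt_iff_not_hyp` — for `n ≥ 1` and every bound `E`, the bounded REGULAR step holds
  iff its hypothesis block (resolution in dimension `≤ n` over `M(t)`) FAILS; likewise the uniform regular step
  (`frobeniusTwistStepUniformRegularAt_iff_not_hyp`);
* hence at `n = 1` all four are FALSE for every `E` (`not_frobeniusTwistStepBoundedRegularAt_one`,
  `not_frobeniusTwistStepBoundedAt_one`, `not_frobeniusTwistStepUniformRegularAt_one`, `not_frobeniusTwistStepUniformAt_one`)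
  while the genuine step `FrobeniusTwistStepRegularAt p M 1` is TRUE
  (`frobeniusTwistStepRegularAt_one_and_not_frobeniusTwistStepUniformRegularAt_one`) — the `∃ e` of the residual is
  load-bearing and NOT uniform, even among regular `X₀`;
* `1 ≤ n ≤ 3`: false given FACT-LIST F-02 (`not_frobeniusTwistStepBoundedRegularAt_of_le_three`,
  `not_frobeniusTwistStepUniformRegularAt_of_le_three`); `n = ⊤`: equivalent to «no resolution over `M(t)`»
  (`frobeniusTwistStepBoundedRegularAt_top_iff`), refuted by `ResolutionInChar p`
  (`not_frobeniusTwistStepBoundedRegularAt_top_of_resolutionInChar`);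
* door-2 shape: `not_forall_isAlgClosed_frobeniusTwistStepUniformRegularAt_one`;
* the conclusion block of `FrobeniusTwistStepBoundedAt p M 1 e₀` (no regularity) fails for every `e₀`
  (`not_hasSmoothFrobeniusTwistModelLe_forall_one`, from the gen-3 `not_exists_uniform_frobeniusTwist_exponent`).

HONEST FRAMING. OURS bookkeeping; AI work, weaker than expert review; nothing is attributed to H. Hironaka. No
`sorry`, no new axioms.
-/

noncomputable section

set_option linter.dupNamespace false -- mandated namespace of this single-conjunct summit

open _root_.CategoryTheory _root_.CategoryTheory.Limits _root_.AlgebraicGeometry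
open Literature.AlgebraicGeometry.Resolution

namespace Summit.ResolutionOfSingularities.ResolutionOfSingularities.Theorems.CampaignW82

variable (p : ℕ) [Fact p.Prime] (M : Type) [Field M] [CharP M p]

/-- **The bounded REGULAR step holds iff its hypothesis fails** (`n ≥ 1`, every bound `E`): by
`TwistExponent.boundedFrobeniusTwistStepRegularAt_iff_not_hyp` (the def's body is that theorem's left side, binder
for binder). [folklore] -/
theorem frobeniusTwistStepBoundedRegularAt_iff_not_hyp {n : WithBot ℕ∞} (hn : 1 ≤ n) (E : ℕ) :
    FrobeniusTwistStepBoundedRegularAt p M n E ↔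
      ¬ ∀ (X : Scheme.{0}) (f : X ⟶ Spec (.of (RatFunc M))),
        IsSeparated f → LocallyOfFiniteType f → QuasiCompact f → IsIntegral X →
          topologicalKrullDim X ≤ n → Scheme.HasResolution X :=
  TwistExponent.boundedFrobeniusTwistStepRegularAt_iff_not_hyp p M hn E

/-- **`¬ FrobeniusTwistStepBoundedRegularAt p M 1 E`** for every `E` (witness: the REGULAR curves
`y^q = x^{p^{E+1}} − t`). [folklore] -/
theorem not_frobeniusTwistStepBoundedRegularAt_one (E : ℕ) : ¬ FrobeniusTwistStepBoundedRegularAt p M 1 E :=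
  (TwistExponent.frobeniusTwistStepRegularAt_one_and_not_bounded p M E).2

/-- **`¬ FrobeniusTwistStepBoundedAt p M 1 E`** for every `E`. [folklore] -/
theorem not_frobeniusTwistStepBoundedAt_one (E : ℕ) : ¬ FrobeniusTwistStepBoundedAt p M 1 E := fun h =>
  not_frobeniusTwistStepBoundedRegularAt_one p M E (frobeniusTwistStepBoundedRegularAt_of_frobeniusTwistStepBoundedAt h)

/-- **`¬ FrobeniusTwistStepUniformRegularAt p M 1`**: no uniform exponent even among regular `X₀`. [folklore] -/
theorem not_frobeniusTwistStepUniformRegularAt_one : ¬ FrobeniusTwistStepUniformRegularAt p M 1 := fun ⟨E, h⟩ =>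
  not_frobeniusTwistStepBoundedRegularAt_one p M E h

/-- **`¬ FrobeniusTwistStepUniformAt p M 1`**: the «∃∀» strengthening (s3) of the residual is false at grade `1`.
[folklore] -/
theorem not_frobeniusTwistStepUniformAt_one : ¬ FrobeniusTwistStepUniformAt p M 1 := fun h =>
  not_frobeniusTwistStepUniformRegularAt_one p M (frobeniusTwistStepUniformRegularAt_of_frobeniusTwistStepUniformAt h)

/-- **TIGHTNESS BY NAME at grade `1`**: the genuine regular step holds (res-L1-s82-pv-1's
`frobeniusTwistStepRegularAt_of_le_one`) while its uniform-exponent strengthening fails. [folklore] -/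
theorem frobeniusTwistStepRegularAt_one_and_not_frobeniusTwistStepUniformRegularAt_one :
    FrobeniusTwistStepRegularAt p M 1 ∧ ¬ FrobeniusTwistStepUniformRegularAt p M 1 :=
  ⟨frobeniusTwistStepRegularAt_of_le_one p M le_rfl, not_frobeniusTwistStepUniformRegularAt_one p M⟩

/-- **The uniform REGULAR step holds iff its hypothesis fails** (`n ≥ 1`). [folklore] -/
theorem frobeniusTwistStepUniformRegularAt_iff_not_hyp {n : WithBot ℕ∞} (hn : 1 ≤ n) :
    FrobeniusTwistStepUniformRegularAt p M n ↔
      ¬ ∀ (X : Scheme.{0}) (f : X ⟶ Spec (.of (RatFunc M))),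
        IsSeparated f → LocallyOfFiniteType f → QuasiCompact f → IsIntegral X →
          topologicalKrullDim X ≤ n → Scheme.HasResolution X :=
  ⟨fun ⟨E, h⟩ => (frobeniusTwistStepBoundedRegularAt_iff_not_hyp p M hn E).mp h,
    fun h => ⟨0, (frobeniusTwistStepBoundedRegularAt_iff_not_hyp p M hn 0).mpr h⟩⟩

/-- **`1 ≤ n ≤ 3`: the bounded regular step is false for every `E`, CONDITIONAL on FACT-LIST F-02**
(`hCP : CossartPiltant2019`). [cite: CossartPiltant2019, Thm. 1.1] -/
theorem not_frobeniusTwistStepBoundedRegularAt_of_le_three (hCP : CossartPiltant2019.{0}) {n : WithBot ℕ∞}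
    (h1 : 1 ≤ n) (h3 : n ≤ 3) (E : ℕ) : ¬ FrobeniusTwistStepBoundedRegularAt p M n E :=
  TwistExponent.not_boundedFrobeniusTwistStepRegularAt_of_le_three p M hCP h1 h3 E

/-- **`1 ≤ n ≤ 3`: the uniform regular step is false, CONDITIONAL on F-02.** [cite: CossartPiltant2019, Thm. 1.1] -/
theorem not_frobeniusTwistStepUniformRegularAt_of_le_three (hCP : CossartPiltant2019.{0}) {n : WithBot ℕ∞}
    (h1 : 1 ≤ n) (h3 : n ≤ 3) : ¬ FrobeniusTwistStepUniformRegularAt p M n := fun ⟨E, h⟩ =>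
  not_frobeniusTwistStepBoundedRegularAt_of_le_three p M hCP h1 h3 E h

/-- **At `n = ⊤` the bounded regular step is «no resolution over `M(t)`»** (every `E`). [folklore] -/
theorem frobeniusTwistStepBoundedRegularAt_top_iff (E : ℕ) :
    FrobeniusTwistStepBoundedRegularAt p M ⊤ E ↔
      ¬ ∀ (X : Scheme.{0}) (f : X ⟶ Spec (.of (RatFunc M))),
        IsSeparated f → LocallyOfFiniteType f → QuasiCompact f → IsIntegral X → Scheme.HasResolution X :=
  TwistExponent.boundedFrobeniusTwistStepRegularAt_top_iff p M E

/-- `ResolutionInChar p` refutes the bounded regular step at `⊤` (every `E`, every `M`). [folklore] -/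
theorem not_frobeniusTwistStepBoundedRegularAt_top_of_resolutionInChar (h : ResolutionInChar.{0} p) (E : ℕ) :
    ¬ FrobeniusTwistStepBoundedRegularAt p M ⊤ E :=
  TwistExponent.not_boundedFrobeniusTwistStepRegularAt_top_of_resolutionInChar p M h E

/-- **Door 2's shape**: the uniform regular step at grade `1` does not hold for every algebraically closed `M` of
characteristic `p` (indeed for none). [folklore] -/
theorem not_forall_isAlgClosed_frobeniusTwistStepUniformRegularAt_one :
    ¬ ∀ (M : Type) [Field M] [CharP M p] [IsAlgClosed M], FrobeniusTwistStepUniformRegularAt p M 1 := fun h =>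
  not_frobeniusTwistStepUniformRegularAt_one p (AlgebraicClosure (ZMod p)) (h (AlgebraicClosure (ZMod p)))

/-- **The conclusion block of `FrobeniusTwistStepBoundedAt p M 1 e₀` fails for every `e₀`** (no regularity
hypothesis; from the gen-3 `TwistExponent.not_exists_uniform_frobeniusTwist_exponent`). [folklore] -/
theorem not_hasSmoothFrobeniusTwistModelLe_forall_one (e₀ : ℕ) :
    ¬ ∀ (X₀ : Scheme.{0}) (f₀ : X₀ ⟶ Spec (.of (RatFunc M))),
      IsSeparated f₀ → LocallyOfFiniteType f₀ → QuasiCompact f₀ → topologicalKrullDim X₀ ≤ 1 →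
        IntegralOverPerfectClosure (RatFunc M) f₀ → HasSmoothFrobeniusTwistModelLe p (RatFunc M) f₀ e₀ := by
  intro h
  refine TwistExponent.not_exists_uniform_frobeniusTwist_exponent p M ⟨e₀, ?_⟩
  intro X₀ f₀ hs hl hq hd hint
  exact h X₀ f₀ hs hl hq hd hint

end Summit.ResolutionOfSingularities.ResolutionOfSingularities.Theorems.CampaignW82

end
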